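import Summits.QuantumFields.YangMills.Theorems.FlatTubeReductionBOAssemblySlowRate
import Summits.QuantumFields.YangMills.Theorems.LuscherReductionTwistedTraceScalingBOAssembly
import HarnessLib

/-!
# `BORateBricks`: the typed BRICK LIST of the RATE-GRADE Born–Oppenheimer tube package (adapted fibres, dressed weight) — rate twin of lane A's `…BOAssemblyBricks`
# (route `FlatTubeReduction`, crux K1 `NearFlatRatioLaw` stmt-QuantumFields-24720; seat `ym-line-ftr-p1` g9; R2b1 RECORD rung — no summit statement is proved here)

The registered stub of the crux (`stub_ratePackage`, skeleton «ratepack») is `∀ L ≥ 2, RateTube.SoftTubeBORatePackageOn L χ_big {orbitDist < β^{−1/40}}`.  THIS FILE types the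
BRICK LIST of the rate twin — lane A's `BOBricks` (p648135) with (i) an ADAPTED, EQUIVARIANT fibre profile `Ω β u v`, (ii) a DRESSED one-site weight `W β u` (`0 ≤ W ≤ 1`, gauge
invariant; `W² = λ(u)/λ(1)`), (iii) rate-grade smallness `κ, b² = O(λ_b²)`, (iv) the kernel brick (B-T) against the dressed form `⟨φW, K_BφW⟩`, (v) the dressed near-top amplitude
`hTop` (`⟨φ₀W,K_Bφ₀W⟩ ≥ e^{−C''λ_b²}μ₀‖φ₀‖²`, supp ⊆ 𝒰: `Quasimode.exists_concentrated_quasimode_levelValue` p647846 transported to `φ₀ := φ/W`) —: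
* `BORateBricks L χ δ` (structure); `remainder_propsAd`;
* the assembly `softTubeBORatePackageOn_of_rateBricks` and the two cruxes from rate bricks are the next file `…BOAssemblyRate.lean`.
HONEST FRAMING: the four analytic bricks (B-T)(B-ST)(B-OD)(B-N) at rate grade and `hTop` are OPEN fixed-lattice semiclassics (pooled with RED lane A's C4-CORE); this file is
assembly algebra; femto rung R2b1 (RECORD label); not infinite volume, not a gap, not Clay.  One new `structure`, no named facts, no `sorry`.
-/

set_option autoImplicit false

noncomputable section

open MeasureTheory Filter Topology Real
open scoped BigOperators
open Literature.MathematicalPhysics.QuantumFieldTheory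
open Literature.MathematicalPhysics.QuantumLattice

namespace Summit.QuantumFields.YangMills.Theorems.FemtoTransferGap.RateTube

open Summit.QuantumFields.YangMills.Theorems.FemtoTransferGap
open Summit.QuantumFields.YangMills.Theorems.FemtoTransferGap.TwoLattice.Avg
open Summit.QuantumFields.YangMills.Theorems.FemtoTransferGap.TwoLattice.ConstTube
open Summit.QuantumFields.YangMills.Theorems.FemtoTransferGap.TwoLattice.Stiff (LinkSpace)

variable (L : ℕ) [NeZero L]

/-! ## §1 The rate-grade brick list -/

/-- **THE RATE-GRADE BORN–OPPENHEIMER BRICK LIST** for a weight family `χ` and a test-support radius `δ` (rate twin of lane A's `BOBricks`, COARSE-DESIGN §24.4): data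
(ADAPTED equivariant fibre profile `Ω β u v`, DRESSED one-site weight `W β u`, slow window, constants) + structural hypotheses + the analytic bricks at RATE grade
(`κ, b² = O(λ_b²)`; (B-T) against the dressed one-site form; the dressed near-top amplitude `hTop`); `softTubeBORatePackageOn_of_rateBricks` (next file) turns it into
`RateTube.SoftTubeBORatePackageOn L χ {orbitDist < δ}`. [cite: Luscher1983, §3] [cite: SjostrandZworski2007, §2] -/
structure BORateBricks (χ : ℝ → GaugeConfig 3 L SU2 → ℝ) (δ : ℝ → ℝ) where
  /-- ADAPTED fibre profile `Ω β u v` (equivariant under global colour rotations) -/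
  Ω : ℝ → GaugeConfig 3 1 SU2 → LinkSpace L → ℝ
  /-- DRESSED one-site weight `W β u` (`W² = λ(u)/λ(1)`: frozen-fibre zero-point energy + FP ratio), `0 ≤ W ≤ 1`, gauge invariant -/
  W : ℝ → GaugeConfig 3 1 SU2 → ℝ
  /-- slow window -/
  𝒰 : ℝ → Set (GaugeConfig 3 1 SU2)
  /-- fibre energy factor, fibre mass, relative error, off-diagonal size, lower bound of `χ` on its support -/
  σ : ℝ → ℝ
  γ : ℝ → ℝ
  κ : ℝ → ℝ
  b : ℝ → ℝ
  c : ℝ → ℝ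
  /-- stiff gap, one-site window radius, BO support radius, copy margin -/
  θ₀ : ℝ
  δ₁ : ℝ → ℝ
  δ₂ : ℝ → ℝ
  m : ℝ
  -- structural hypotheses
  hχm : ∀ β, Measurable (χ β)
  hχ1 : ∀ β U, |χ β U| ≤ 1
  hχ0 : ∀ β U, 0 ≤ χ β U
  hc : ∀ β, 0 < c β ∧ ∀ U, χ β U ≠ 0 → c β ≤ χ β U
  hwm : ∀ β, Measurable (softWeight (χ β))
  hwb : ∀ β, ∃ Cw : ℝ, ∀ U, |softWeight (χ β) U| ≤ Cw
  hw0 : ∀ β U, 0 ≤ softWeight (χ β) U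
  hwinv : ∀ β (g : SU2) (U : GaugeConfig 3 L SU2), softWeight (χ β) (gaugeTransform (fun _ : Site 3 L => g) U) = softWeight (χ β) U
  hΩm : ∀ β, Measurable (Function.uncurry (Ω β))
  hΩ1 : ∀ β u x, |Ω β u x| ≤ 1
  hΩinv : ∀ β (g : SU2) (u : GaugeConfig 3 1 SU2) (v : LinkSpace L), Ω β (gaugeTransform (fun _ : Site 3 1 => g) u) (adL L g v) = Ω β u v
  hWm : ∀ β, Measurable (W β)
  hW0 : ∀ β u, 0 ≤ W β u
  hW1 : ∀ β u, W β u ≤ 1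
  hWinv : ∀ β (g : Site 3 1 → SU2) (u : GaugeConfig 3 1 SU2), W β (gaugeTransform g u) = W β u
  h𝒰m : ∀ β, MeasurableSet (𝒰 β)
  h𝒰inv : ∀ β (g : SU2) (u : GaugeConfig 3 1 SU2), gaugeTransform (fun _ : Site 3 1 => g) u ∈ 𝒰 β ↔ u ∈ 𝒰 β
  h𝒰δ₁ : ∀ β, ∀ u ∈ 𝒰 β, orbitDist u < δ₁ β
  hδ₁ : ∀ᶠ β in atTop, δ₁ β ≤ 1 / 2
  htube : ∀ᶠ β in atTop, ∀ U, χ β U ≠ 0 → U ∈ orthoTubeSet L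
  hshadow : ∀ᶠ β in atTop, ∀ U, χ β U ≠ 0 → orbitDist U < δ β → slowMean L U ∈ 𝒰 β
  hbo : ∀ᶠ β in atTop, ∀ (φ : GaugeConfig 3 1 SU2 → ℝ) (U : GaugeConfig 3 L SU2), (∀ u, φ u ≠ 0 → u ∈ 𝒰 β) → boFunAd L φ (Ω β) U ≠ 0 → χ β U ≠ 0 ∧ orbitDist U < δ₂ β
  hm : 0 ≤ m
  hm0 : 0 < m
  hδ₂ : ∀ᶠ β in atTop, (L : ℝ) * (δ₂ β + m) < 2
  hσ : ∀ β, 0 < σ β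
  hγ : ∀ β, 0 < γ β
  hκ : ∀ β, 0 ≤ κ β
  hb : ∀ β, 0 ≤ b β
  hθ₀ : 0 < θ₀ ∧ θ₀ ≤ 1
  hκ_small : ∃ a : ℝ, ∀ᶠ β in atTop, κ β ≤ a * bareLambda ((L : ℝ) ^ 3 * β) ^ 2
  hb_small : ∃ a : ℝ, ∀ᶠ β in atTop, b β ^ 2 ≤ a * bareLambda ((L : ℝ) ^ 3 * β) ^ 2
  -- the analytic bricks (RATE grade: `κ, b² = O(λ_b²)`; DRESSED one-site form `⟨φW, K_BφW⟩`)
  hTop : ∃ C'' : ℝ, ∀ᶠ β in atTop, ∃ φ₀ : GaugeConfig 3 1 SU2 → ℝ, Measurable φ₀ ∧ (∃ C : ℝ, ∀ u, |φ₀ u| ≤ C) ∧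
    (∀ (g : Site 3 1 → SU2) (u : GaugeConfig 3 1 SU2), φ₀ (gaugeTransform g u) = φ₀ u) ∧ (∀ u, φ₀ u ≠ 0 → u ∈ 𝒰 β) ∧ 0 < l2 φ₀ φ₀ ∧
    Real.exp (-(C'' * bareLambda ((L : ℝ) ^ 3 * β) ^ 2)) * levelValue su2Rep 1 ((L : ℝ) ^ 3 * β) 0 * l2 φ₀ φ₀ ≤
      qform su2Rep ((L : ℝ) ^ 3 * β) (fun u => φ₀ u * W β u) (fun u => φ₀ u * W β u)
  hN : ∀ᶠ β in atTop, ∀ u ∈ 𝒰 β, |fibreMassAd L (softWeight (χ β)) (Ω β) u - γ β| ≤ κ β * γ β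
  hT : ∀ᶠ β in atTop, ∀ φ : GaugeConfig 3 1 SU2 → ℝ, Measurable φ → (∃ C : ℝ, ∀ u, |φ u| ≤ C) →
    (∀ (g : Site 3 1 → SU2) (u : GaugeConfig 3 1 SU2), φ (gaugeTransform g u) = φ u) → (∀ u, φ u ≠ 0 → u ∈ 𝒰 β) →
    |tubeForm β (boFunAd L φ (Ω β)) - σ β * γ β * qform su2Rep ((L : ℝ) ^ 3 * β) (fun u => φ u * W β u) (fun u => φ u * W β u)| ≤
      κ β * (σ β * γ β) * (qform su2Rep ((L : ℝ) ^ 3 * β) (fun u => φ u * W β u) (fun u => φ u * W β u) + levelValue su2Rep 1 ((L : ℝ) ^ 3 * β) 0 * l2 φ φ)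
  hST : ∀ᶠ β in atTop, ∀ v : GaugeConfig 3 L SU2 → ℝ, Measurable v → (∃ C : ℝ, ∀ U, |v U| ≤ C) → (∀ U, v U ≠ 0 → χ β U ≠ 0) →
    (∀ u, fibreInnerAd L (softWeight (χ β)) (Ω β) v u = 0) →
    tubeForm β v ≤ (1 - θ₀) * (σ β * levelValue su2Rep 1 ((L : ℝ) ^ 3 * β) 0) * tubeNormSq (softWeight (χ β)) v
  hOD : ∀ᶠ β in atTop, ∀ (φ : GaugeConfig 3 1 SU2 → ℝ) (v : GaugeConfig 3 L SU2 → ℝ), Measurable φ → (∃ C : ℝ, ∀ u, |φ u| ≤ C) → (∀ u, φ u ≠ 0 → u ∈ 𝒰 β) →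
    Measurable v → (∃ C : ℝ, ∀ U, |v U| ≤ C) → (∀ U, v U ≠ 0 → χ β U ≠ 0) → (∀ u, fibreInnerAd L (softWeight (χ β)) (Ω β) v u = 0) →
    |tubeCross β (boFunAd L φ (Ω β)) v| ≤ b β * (σ β * levelValue su2Rep 1 ((L : ℝ) ^ 3 * β) 0) *
        Real.sqrt (tubeNormSq (softWeight (χ β)) (boFunAd L φ (Ω β))) * Real.sqrt (tubeNormSq (softWeight (χ β)) v) ∧
    |tubeCross β v (boFunAd L φ (Ω β))| ≤ b β * (σ β * levelValue su2Rep 1 ((L : ℝ) ^ 3 * β) 0) *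
        Real.sqrt (tubeNormSq (softWeight (χ β)) (boFunAd L φ (Ω β))) * Real.sqrt (tubeNormSq (softWeight (χ β)) v)


/-! ## §2 Supports and fibrewise orthogonality of the remainder (adapted profile) -/

variable {L}

/-- The remainder of a test function supported in `supp χ` with slow shadow in `𝒰` is supported in `supp χ` and fibrewise `w`-orthogonal to `Ω` over EVERY slow point. [folklore] -/
theorem remainder_propsAd {χ w : GaugeConfig 3 L SU2 → ℝ} (hw : Measurable w) {Cw : ℝ} (hCw : ∀ U, |w U| ≤ Cw) {Ω : GaugeConfig 3 1 SU2 → LinkSpace L → ℝ} (hΩ : Measurable (Function.uncurry Ω)) {CΩ : ℝ}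
    (hCΩ : ∀ u x, |Ω u x| ≤ CΩ) {𝒰 : Set (GaugeConfig 3 1 SU2)} (h𝒰 : MeasurableSet 𝒰) {Z₀ : ℝ} (hZ₀ : 0 < Z₀) (hZ : ∀ u ∈ 𝒰, Z₀ ≤ fibreMassAd L w Ω u)
    (hbo : ∀ (φ : GaugeConfig 3 1 SU2 → ℝ) (U : GaugeConfig 3 L SU2), (∀ u, φ u ≠ 0 → u ∈ 𝒰) → boFunAd L φ Ω U ≠ 0 → χ U ≠ 0)
    {f : GaugeConfig 3 L SU2 → ℝ} (hf : Measurable f) {Cf : ℝ} (hCf : ∀ U, |f U| ≤ Cf) (hfs : ∀ U, f U ≠ 0 → χ U ≠ 0) (hfsh : ∀ U, f U ≠ 0 → slowMean L U ∈ 𝒰) :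
    (∀ U, f U - boProjAd L w Ω 𝒰 f U ≠ 0 → χ U ≠ 0) ∧ ∀ u, fibreInnerAd L w Ω (fun U => f U - boProjAd L w Ω 𝒰 f U) u = 0 := by
  have hcs : ∀ u, boCoeffAd L w Ω 𝒰 f u ≠ 0 → u ∈ 𝒰 := fun u hu => by
    by_contra hnu; exact hu (show boCoeffAd L w Ω 𝒰 f u = 0 by unfold boCoeffAd; rw [Set.indicator_of_notMem hnu])
  refine ⟨fun U hU => ?_, fun u => ?_⟩
  · by_cases hfU : f U = 0
    · rw [hfU, zero_sub, neg_ne_zero] at hU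
      exact hbo _ U hcs hU
    · exact hfs U hfU
  · by_cases hu : u ∈ 𝒰
    · exact fibreInnerAd_sub_boProjAd hw hCw hΩ hCΩ h𝒰 hZ₀ hZ hf hCf hu
    · refine fibreInnerAd_eq_zero_of_vanish fun v hv => ?_
      have h1 : f (orthoTube L u v) = 0 := by
        by_contra h; exact hu (by rw [← slowMean_orthoTube L u hv]; exact hfsh _ h)
      have h2 : boProjAd L w Ω 𝒰 f (orthoTube L u v) = 0 := by
        unfold boProjAd; rw [boFunAd_orthoTube L _ Ω u hv]; unfold boCoeffAd; rw [Set.indicator_of_notMem hu, zero_mul]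
      rw [h1, h2, sub_zero]


end Summit.QuantumFields.YangMills.Theorems.FemtoTransferGap.RateTube

end
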